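import Summits.ResolutionOfSingularities.ResolutionOfSingularities.Theses.AbhyankarShadows
import Summits.ResolutionOfSingularities.ResolutionOfSingularities.Theorems.ValuativePatchingRelRegularBlowupLine
import Summits.ResolutionOfSingularities.ResolutionOfSingularities.Theorems.RegularBlowupsDesingularization
import Summits.ResolutionOfSingularities.ResolutionOfSingularities.Theorems.ValuativePatchingRelAxiomFourEquivalence
import Literature.AlgebraicGeometry.Resolution.ZariskiPatchingAllDimensions
import Literature.AlgebraicGeometry.Resolution.ProjectiveBirationalBlowupProofs

/-!
# Negative-lane lemmas for crux `PatchingPerfect` (stmt-ResolutionOfSingularities-16089), line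
# `birth`: the exact residual of its two open stubs, and the quasi-projective slack

The registered skeleton `Cruxes/PatchingPerfect/Lines/birth.lean` cuts the crux at three stubs:
`stub_principalizationPerfect` (Piltant's Axiom 4 in blow-up format on regular varieties over a
perfect field: `PrincipalizationAt k`), `stub_badPointsPerfect` (exceptional-admissible ⇒
Sing-admissible blow-up desingularization of blowings up of regular varieties: `ExcAdmissibleAt k →
SingAdmissibleAt k`) and `stub_liu2002` (Liu 2002 Thm. 8.1.24, which is the tree THEOREM
`Liu2002Thm8124Projective_holds`). Findings of the standing disprover (cdisprove g2,
`Cruxes/PatchingPerfect/Disproof.lean` §4–§5), all PROVED, the stub predicates written out verbatim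
(no new `def`), FIELDWISE over an arbitrary field `k` (perfectness and the characteristic are
consumed nowhere):

* `patchingPerfect_birth_excAdmissible_of_principalization`,
  `patchingPerfect_birth_principalization_of_excAdmissible` — stub 1 at `k` IS exceptional-admissible
  desingularization at `k` (Stacks 080A backwards / Temkin 2008 Lemma 2.1.4; the per-field slices
  of the tree's `principalizationInChar_iff_regularBlowupExcAdmissible`).
* `patchingPerfect_birth_excAdmissible_of_singAdmissible` — Sing-admissible ⇒ exceptional-admissible
  at `k` (`Sing (Bl_I U) ⊆ η⁻¹ V(I)` for regular `U`).
* `patchingPerfect_birthStubsAt_iff_singAdmissibleAt` — **THE RESIDUAL, exactly**: at every field,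
  (stub 1 ∧ stub 2) ⟺ Sing-admissible blow-up desingularization of blowings up of regular
  `k`-varieties — the per-field slice of the sibling crux `PatchingRel`'s strong blow-up atom on
  `Bl_I U` (`RegularBlowupSingAdmissibleResolution`), whose line `sandwiched-gluing` is line-dead.
  The cut "Axiom 4 + bad points" neither loses nor gains anything.
* `patchingPerfect_birth_resolves_of_singAdmissibleQProj_of_relLU` — **SLACK**: the crux's body at
  `k` (relative LU over `k` ⇒ weak resolution over `k`) already follows from the QUASI-PROJECTIVE
  Sing-admissible atom at `k` (the atom is only ever evaluated at `U = Reg Y ↪ Y ↪ ℙⁿ_k`, `Y` a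
  projective model; Liu 8.1.24 discharged in the tree; engine
  `resolutionOverUpToDim_of_twoModelPatching_of_relLU`). So both open stubs may be restricted to
  quasi-projective regular `U` — the print-faithful scope of Piltant's Axiom 4 / Prop. 5.1
  (projective models) — at no cost, and stub 3 dropped.
-/

noncomputable section

set_option linter.dupNamespace false

open CategoryTheory CategoryTheory.Limits AlgebraicGeometry TopologicalSpace
open Literature.AlgebraicGeometry.Resolution Literature.AlgebraicGeometry.Motives
open Summit.ResolutionOfSingularities.ResolutionOfSingularities.Theorems

namespace Summit.ResolutionOfSingularities.ResolutionOfSingularities.Theorems.PatchingPerfect.Negative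

/-- **Stub 1 ⇒ exceptional-admissible desingularization, at one field** (Stacks 080A read
backwards: for a principalization `σ : Bl_Q U → U` of `I` with regular source,
`Bl_{η⁻¹Q}(Bl_I U) ≅ Bl_Q U`; `η⁻¹Q ≠ 0` because `Bl_I U` has points over `U ∖ V(I)`).
[cite: StacksProject, Tag 080A] -/
theorem patchingPerfect_birth_excAdmissible_of_principalization (k : Type) [Field k]
    (hP : ∀ (U : Scheme.{0}) (f : U ⟶ Spec (.of k)),
      IsSeparated f → LocallyOfFiniteType f → QuasiCompact f → IsIntegral U → Scheme.IsRegular U →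
      ∀ I : U.IdealSheafData, I ≠ ⊥ →
        ∃ (Q : U.IdealSheafData) (U' : Scheme.{0}) (σ : U' ⟶ U),
          (Q.support : Set U) ⊆ I.support ∧ IsBlowup σ Q ∧ Scheme.IsRegular U' ∧
            IsEffectiveCartier (I.comap σ)) :
    ∀ (U V : Scheme.{0}) (f : U ⟶ Spec (.of k)) (η : V ⟶ U) (I : U.IdealSheafData),
      IsSeparated f → LocallyOfFiniteType f → QuasiCompact f → IsIntegral U → Scheme.IsRegular U →
      I ≠ ⊥ → IsBlowup η I →
        ∃ (J : V.IdealSheafData) (V' : Scheme.{0}) (π : V' ⟶ V),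
          J ≠ ⊥ ∧ (J.support : Set V) ⊆ η ⁻¹' (I.support : Set U) ∧ IsBlowup π J ∧
            Scheme.IsRegular V' := by
  intro U V f η I hf₁ hf₂ hf₃ hU hUreg hI hη
  haveI := hf₁; haveI := hf₂; haveI := hf₃; haveI := hU
  obtain ⟨Q, U', σ, hQI, hσ, hreg, hcart⟩ := hP U f hf₁ hf₂ hf₃ hU hUreg I hI
  obtain ⟨V', π, hπ, hreg'⟩ := exists_isBlowup_comap_isRegular hσ hreg hcart hη
  refine ⟨Q.comap η, V', π, ?_, ?_, hπ, hreg'⟩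
  · intro h
    have hsupp : ((Q.comap η).support : Set V) = Set.univ := by
      rw [h, Scheme.IdealSheafData.support_bot]; rfl
    rw [Scheme.IdealSheafData.support_comap] at hsupp
    obtain ⟨u, hu⟩ := centreCompl_nonempty (J := I) hI
    let W : U.Opens := ⟨(I.support : Set U)ᶜ, I.support.isClosed.isOpen_compl⟩
    haveI : IsIso (η ∣_ W) := hη.isIso_compl
    obtain ⟨v, hv⟩ := (ConcreteCategory.bijective_of_isIso (η ∣_ W).base).2 ⟨u, hu⟩
    have hηv : η ((η ⁻¹ᵁ W).ι v) = u := by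
      have := morphismRestrict_base_coe η W v
      rw [hv] at this
      exact this.symm
    have hmem : (η ⁻¹ᵁ W).ι v ∈ (TopologicalSpace.Closeds.preimage (Q.support) η.continuous :
        Set V) := by rw [hsupp]; trivial
    rw [TopologicalSpace.Closeds.coe_preimage, Set.mem_preimage, hηv] at hmem
    exact hu (hQI hmem)
  · intro v hv
    rw [Scheme.IdealSheafData.support_comap] at hv
    exact hQI hv

/-- **Exceptional-admissible desingularization ⇒ stub 1, at one field** (Temkin 2008, Lemma
2.1.4: the composite `Bl_J (Bl_I U) → Bl_I U → U` is ONE `V(I)`-supported blowing up of the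
Noetherian `U`, with regular source, and it principalizes `I` — `I𝒪_{Bl_I U}` is an effective
Cartier divisor and stays one after pull-back along the dominant quasi-compact `Bl_J → Bl_I U`).
[cite: Temkin2008, Lemma 2.1.4] [cite: Piltant2013, §2 Axiom 4] -/
theorem patchingPerfect_birth_principalization_of_excAdmissible (k : Type) [Field k]
    (h : ∀ (U V : Scheme.{0}) (f : U ⟶ Spec (.of k)) (η : V ⟶ U) (I : U.IdealSheafData),
      IsSeparated f → LocallyOfFiniteType f → QuasiCompact f → IsIntegral U → Scheme.IsRegular U →
      I ≠ ⊥ → IsBlowup η I →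
        ∃ (J : V.IdealSheafData) (V' : Scheme.{0}) (π : V' ⟶ V),
          J ≠ ⊥ ∧ (J.support : Set V) ⊆ η ⁻¹' (I.support : Set U) ∧ IsBlowup π J ∧
            Scheme.IsRegular V') :
    ∀ (U : Scheme.{0}) (f : U ⟶ Spec (.of k)),
      IsSeparated f → LocallyOfFiniteType f → QuasiCompact f → IsIntegral U → Scheme.IsRegular U →
      ∀ I : U.IdealSheafData, I ≠ ⊥ →
        ∃ (Q : U.IdealSheafData) (U' : Scheme.{0}) (σ : U' ⟶ U),
          (Q.support : Set U) ⊆ I.support ∧ IsBlowup σ Q ∧ Scheme.IsRegular U' ∧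
            IsEffectiveCartier (I.comap σ) := by
  intro U f hf₁ hf₂ hf₃ hU hUreg I hI
  haveI := hf₁; haveI := hf₂; haveI := hf₃; haveI := hU
  haveI : IsLocallyNoetherian U := LocallyOfFiniteType.isLocallyNoetherian f
  haveI : CompactSpace U := QuasiCompact.compactSpace_of_compactSpace f
  haveI : IsNoetherian U := {}
  let η : blowup I ⟶ U := blowup.π I
  have hη : IsBlowup η I := blowup.isBlowup I
  obtain ⟨J, V', π, hJ, hJexc, hπ, hreg⟩ := h U (blowup I) f η I hf₁ hf₂ hf₃ hU hUreg hI hη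
  obtain ⟨Q, hQ, hQT⟩ :=
    hη.exists_isBlowup_comp_supported η I π J (I.support : Set U) subset_rfl hπ hJexc
  refine ⟨Q, V', π ≫ η, hQT, hQ, hreg, ?_⟩
  haveI : IsIntegral (blowup I) := hη.isIntegral hI
  haveI : IsIntegral V' := hπ.isIntegral hJ
  haveI : IsDominant π := (hπ.isBirational' hJ).isDominant
  haveI : IsProper η := hη.isProper
  haveI : IsLocallyNoetherian (blowup I) := LocallyOfFiniteType.isLocallyNoetherian (η ≫ f)
  haveI : IsProper π := hπ.isProper
  rw [Scheme.IdealSheafData.comap_comp]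
  exact hη.isEffectiveCartier.comap_of_isDominant π

/-- **Sing-admissible ⇒ exceptional-admissible, at one field**: the singular locus of a blowing
up of a regular `U` along `I` lies over `V(I)` (off `V(I)` the blowing up is an isomorphism onto
a regular open; tree `mem_preimage_support_of_not_isRegular`).
[cite: GortzWedhorn2020, Prop. 13.91 (3)] -/
theorem patchingPerfect_birth_excAdmissible_of_singAdmissible (k : Type) [Field k]
    (h : ∀ (U V : Scheme.{0}) (f : U ⟶ Spec (.of k)) (η : V ⟶ U) (I : U.IdealSheafData),
      IsSeparated f → LocallyOfFiniteType f → QuasiCompact f → IsIntegral U → Scheme.IsRegular U →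
      I ≠ ⊥ → IsBlowup η I →
        ∃ (J : V.IdealSheafData) (V' : Scheme.{0}) (π : V' ⟶ V),
          J ≠ ⊥ ∧ (∀ x : V, x ∈ J.support → ¬ IsRegularLocalRing (V.presheaf.stalk x)) ∧
            IsBlowup π J ∧ Scheme.IsRegular V') :
    ∀ (U V : Scheme.{0}) (f : U ⟶ Spec (.of k)) (η : V ⟶ U) (I : U.IdealSheafData),
      IsSeparated f → LocallyOfFiniteType f → QuasiCompact f → IsIntegral U → Scheme.IsRegular U →
      I ≠ ⊥ → IsBlowup η I →
        ∃ (J : V.IdealSheafData) (V' : Scheme.{0}) (π : V' ⟶ V),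
          J ≠ ⊥ ∧ (J.support : Set V) ⊆ η ⁻¹' (I.support : Set U) ∧ IsBlowup π J ∧
            Scheme.IsRegular V' := by
  intro U V f η I hf₁ hf₂ hf₃ hU hUreg hI hη
  obtain ⟨J, V', π, hJ, hJsing, hπ, hreg⟩ := h U V f η I hf₁ hf₂ hf₃ hU hUreg hI hη
  exact ⟨J, V', π, hJ, fun v hv => mem_preimage_support_of_not_isRegular hη hUreg (hJsing v hv),
    hπ, hreg⟩

/-- **THE RESIDUAL OF LINE `birth`, EXACTLY, at every field `k`**: (stub 1 at `k`) ∧ (stub 2 at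
`k`) ⟺ Sing-admissible blow-up desingularization of blowings up of regular `k`-varieties — the
per-field slice of the tree conjecture `RegularBlowupSingAdmissibleResolution` (strong resolution,
in blow-up format, of the basic sandwiched class). In particular the skeleton's
`Sig.stub_principalizationPerfect ∧ Sig.stub_badPointsPerfect` is that conjecture over all perfect
fields of positive characteristic, and nothing weaker. [cite: Piltant2013, §2 Axiom 4 and Def. 5.4]
[cite: Temkin2008, Lemma 2.1.4] -/
theorem patchingPerfect_birthStubsAt_iff_singAdmissibleAt (k : Type) [Field k] :
    ((∀ (U : Scheme.{0}) (f : U ⟶ Spec (.of k)),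
      IsSeparated f → LocallyOfFiniteType f → QuasiCompact f → IsIntegral U → Scheme.IsRegular U →
      ∀ I : U.IdealSheafData, I ≠ ⊥ →
        ∃ (Q : U.IdealSheafData) (U' : Scheme.{0}) (σ : U' ⟶ U),
          (Q.support : Set U) ⊆ I.support ∧ IsBlowup σ Q ∧ Scheme.IsRegular U' ∧
            IsEffectiveCartier (I.comap σ)) ∧
     ((∀ (U V : Scheme.{0}) (f : U ⟶ Spec (.of k)) (η : V ⟶ U) (I : U.IdealSheafData),
        IsSeparated f → LocallyOfFiniteType f → QuasiCompact f → IsIntegral U →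
        Scheme.IsRegular U → I ≠ ⊥ → IsBlowup η I →
          ∃ (J : V.IdealSheafData) (V' : Scheme.{0}) (π : V' ⟶ V),
            J ≠ ⊥ ∧ (J.support : Set V) ⊆ η ⁻¹' (I.support : Set U) ∧ IsBlowup π J ∧
              Scheme.IsRegular V') →
      (∀ (U V : Scheme.{0}) (f : U ⟶ Spec (.of k)) (η : V ⟶ U) (I : U.IdealSheafData),
        IsSeparated f → LocallyOfFiniteType f → QuasiCompact f → IsIntegral U →
        Scheme.IsRegular U → I ≠ ⊥ → IsBlowup η I →
          ∃ (J : V.IdealSheafData) (V' : Scheme.{0}) (π : V' ⟶ V),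
            J ≠ ⊥ ∧ (∀ x : V, x ∈ J.support → ¬ IsRegularLocalRing (V.presheaf.stalk x)) ∧
              IsBlowup π J ∧ Scheme.IsRegular V'))) ↔
    (∀ (U V : Scheme.{0}) (f : U ⟶ Spec (.of k)) (η : V ⟶ U) (I : U.IdealSheafData),
      IsSeparated f → LocallyOfFiniteType f → QuasiCompact f → IsIntegral U → Scheme.IsRegular U →
      I ≠ ⊥ → IsBlowup η I →
        ∃ (J : V.IdealSheafData) (V' : Scheme.{0}) (π : V' ⟶ V),
          J ≠ ⊥ ∧ (∀ x : V, x ∈ J.support → ¬ IsRegularLocalRing (V.presheaf.stalk x)) ∧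
            IsBlowup π J ∧ Scheme.IsRegular V') :=
  ⟨fun h => h.2 (patchingPerfect_birth_excAdmissible_of_principalization k h.1),
    fun h => ⟨patchingPerfect_birth_principalization_of_excAdmissible k
      (patchingPerfect_birth_excAdmissible_of_singAdmissible k h), fun _ => h⟩⟩

/-- **SLACK: the quasi-projective Sing-admissible atom at `k`, with relative LU over `k`, already
gives weak resolution over `k`** — the crux's body at `(p, k)` for EVERY field `k`. The atom is
evaluated once, at the regular QUASI-PROJECTIVE `U = Reg Y ↪ Y ↪ ℙⁿ_k` of a projective model
`Y`: Liu 8.1.24 (tree theorem `Liu2002Thm8124Projective_holds`) makes `M → Y` a blowing up, the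
atom RegLe-ifies it (tree `projRegLeification_of_liu_of_regularBlowupSingAdmQProj`, whose
all-fields hypothesis is used at `k` only — its proof verbatim), twice on the join it is two-model
patching of projective models over `k` (`projTwoModelPatching_of_projRegLeification`), and the
engine `resolutionOverUpToDim_of_twoModelPatching_of_relLU` resolves. Hence both open stubs of
`birth` may be restricted to quasi-projective regular `U` (the sibling's cut
`stub_sandwichedBlowupResolutionQProj`; the print-faithful scope of Piltant's Axiom 4 and
Prop. 5.1, which are about projective models). [cite: Piltant2013, Prop. 5.1 and Cor. 5.7]
[cite: Liu2002, Thm. 8.1.24] -/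
theorem patchingPerfect_birth_resolves_of_singAdmissibleQProj_of_relLU (k : Type) [Field k]
    (hS : ∀ (U V : Scheme.{0}) (f : U ⟶ Spec (.of k)) (η : V ⟶ U) (I : U.IdealSheafData),
      IsSeparated f → LocallyOfFiniteType f → QuasiCompact f → IsIntegral U → Scheme.IsRegular U →
      (∃ (P : Scheme.{0}) (πP : P ⟶ Spec (.of k)) (j : U ⟶ P),
        IsProjectiveOver (Over.mk πP) ∧ IsOpenImmersion j ∧ j ≫ πP = f) →
      I ≠ ⊥ → IsBlowup η I →
        ∃ (J : V.IdealSheafData) (V' : Scheme.{0}) (π : V' ⟶ V),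
          J ≠ ⊥ ∧ (∀ x : V, x ∈ J.support → ¬ IsRegularLocalRing (V.presheaf.stalk x)) ∧
            IsBlowup π J ∧ Scheme.IsRegular V')
    (hLU : ∀ (K : Type) [Field K] [Algebra k K], (⊤ : IntermediateField k K).FG →
      ∀ O : ValuationSubring K, (∀ c : k, algebraMap k K c ∈ O) → ∀ R : Subalgebra k K, R.FG →
        R.toSubring ≤ O.toSubring → ∃ (A : Subalgebra k K) (h : A.toSubring ≤ O.toSubring),
          R ≤ A ∧ A.FG ∧ IsFractionRing A K ∧ IsRegularLocalRing (Localization.AtPrime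
            (Ideal.comap (Subring.inclusion h) (IsLocalRing.maximalIdeal O)))) :
    ∀ (X : Scheme.{0}) (f : X ⟶ Spec (.of k)), IsSeparated f → LocallyOfFiniteType f →
      QuasiCompact f → IsReduced X → Scheme.HasResolution X := by
  -- (1) RegLe-ification of one morphism of projective models over `k`
  have hRL : ∀ (K : Type) [Field K] [Algebra k K] (M Y : ProjModel k K) (φ : M.Hom Y),
      ∃ (M' : ProjModel k K) (ψ : M'.Hom M), ψ.RegLe ∧ (ψ.comp φ).RegLe := by
    intro K _ _ M Y φ
    obtain ⟨I, hI, hφblow⟩ := Liu2002Thm8124Projective_holds k M.X Y.X φ.f M.π Y.π inferInstance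
      inferInstance M.isProjectiveOver Y.isProjectiveOver φ.f_π φ.isBirational
    let UY : Y.X.Opens :=
      ⟨Scheme.regularLocus Y.X, isOpen_regularLocus_of_locallyOfFiniteType_field Y.π⟩
    let RM : M.X.Opens :=
      ⟨Scheme.regularLocus M.X, isOpen_regularLocus_of_locallyOfFiniteType_field M.π⟩
    let V : M.X.Opens := φ.f ⁻¹ᵁ UY
    let O : M.X.Opens := V ⊔ RM
    have hVO : V ≤ O := le_sup_left
    have hgenY : genericPoint Y.X ∈ UY := by
      show genericPoint Y.X ∈ Scheme.regularLocus Y.X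
      apply Scheme.genericPoints_subset_regularLocus
      rw [genericPoints_eq_singleton]
      rfl
    haveI : Nonempty (UY : Scheme.{0}) := ⟨⟨_, hgenY⟩⟩
    haveI : IsIntegral (UY : Scheme.{0}) := isIntegral_of_isOpenImmersion UY.ι
    have hUreg : Scheme.IsRegular (UY : Scheme.{0}) := fun u =>
      (isRegularLocalRing_stalk_iff_of_isOpenImmersion UY.ι u).mp u.2
    have hout : ∀ x : M.X, x ∈ O → x ∉ V → IsRegularLocalRing (M.X.presheaf.stalk x) := by
      intro x hx hxV
      rcases Opens.mem_sup.mp hx with h | h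
      · exact absurd h hxV
      · exact h
    have hgenM : genericPoint M.X ∈ RM := by
      show genericPoint M.X ∈ Scheme.regularLocus M.X
      apply Scheme.genericPoints_subset_regularLocus
      rw [genericPoints_eq_singleton]
      rfl
    have hOne : (O : Set M.X).Nonempty := ⟨_, Opens.mem_sup.mpr (Or.inr hgenM)⟩
    haveI : Nonempty (O : Scheme.{0}) := hOne.to_subtype
    haveI : IsIntegral (O : Scheme.{0}) := isIntegral_of_isOpenImmersion O.ι
    let V' : (O : Scheme.{0}).Opens := O.ι ⁻¹ᵁ V
    let e : (V' : Scheme.{0}) ≅ (V : Scheme.{0}) := Scheme.Opens.isoOfLE hVO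
    let η' : (V' : Scheme.{0}) ⟶ (UY : Scheme.{0}) := e.hom ≫ (φ.f ∣_ UY)
    have hη'blow : IsBlowup η' (I.comap UY.ι) := (hφblow.restrict UY).iso_comp e
    have hIne : I.comap UY.ι ≠ ⊥ := by
      intro h
      have hsupp : ((I.comap UY.ι).support : Set (UY : Scheme.{0})) = Set.univ := by
        rw [h, Scheme.IdealSheafData.support_bot]; rfl
      rw [Scheme.IdealSheafData.support_comap, Closeds.coe_preimage] at hsupp
      have hmem : (⟨genericPoint Y.X, hgenY⟩ : (UY : Scheme.{0})) ∈
          UY.ι ⁻¹' (I.support : Set Y.X) := by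
        rw [hsupp]; trivial
      exact not_mem_support_genericPoint hI hmem
    have hout' : ∀ x : (O : Scheme.{0}), x ∉ V' →
        IsRegularLocalRing ((O : Scheme.{0}).presheaf.stalk x) := fun x hx =>
      (isRegularLocalRing_stalk_iff_of_isOpenImmersion O.ι x).mp (hout x.1 x.2 hx)
    -- the atom, at the QUASI-PROJECTIVE regular `Reg Y ↪ Y`
    obtain ⟨J, N₁, π₁, hJ, hJsing, hπ₁, hreg₁⟩ := hS (UY : Scheme.{0}) (V' : Scheme.{0})
      (UY.ι ≫ Y.π) η' (I.comap UY.ι) inferInstance inferInstance inferInstance inferInstance hUreg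
      ⟨Y.X, Y.π, UY.ι, Y.isProjectiveOver, inferInstance, rfl⟩ hIne hη'blow
    obtain ⟨I₀, N₀, π, hI₀, -, hπ, hreg⟩ :=
      exists_isBlowup_of_isBlowup_opens_of_regular_off (O.ι ≫ M.π) V' hout' hJ hJsing hπ₁ hreg₁
    obtain ⟨Z, ρ, s, hZ, hρ, hbir, hs, hsq, hblow⟩ := exists_isPullback_of_isBlowup_opens O hI₀ hπ
    haveI := hZ
    haveI := hρ
    haveI := hs
    have hproj : IsProjectiveOver (Over.mk (ρ ≫ M.π) : SchemeOver k) :=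
      hblow.isProjectiveOver M.π M.isProjectiveOver
    have hregO : ∀ z : Z, ρ z ∈ O → IsRegularLocalRing (Z.presheaf.stalk z) := fun z hz =>
      isRegularLocalRing_stalk_of_isPullback_ι hsq (S := (O : Set M.X)) le_rfl
        (fun m _ => hreg m) z hz
    obtain ⟨M', ψ, e', hψ⟩ := M.exists_projModel_of_isBirational ρ hbir hproj
    subst e'
    rw [eqToHom_refl, Category.id_comp] at hψ
    refine ⟨M', ψ, fun y hy => ?_, fun y hy => ?_⟩
    · rw [hψ] at hy
      have := hregO y (Opens.mem_sup.mpr (Or.inr hy))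
      simpa [hψ] using this
    · rw [ProjModel.Hom.comp_f, Scheme.Hom.comp_apply, hψ] at hy
      have := hregO y (hVO (show φ.f (ρ y) ∈ UY from hy))
      simpa [hψ] using this
  -- (2) two-model patching of projective models over `k`, then the engine
  intro X f hs hl hq hr
  haveI : QuasiCompact f := hq
  haveI : LocallyOfFiniteType f := hl
  haveI : CompactSpace X := QuasiCompact.compactSpace_of_compactSpace f
  obtain ⟨d, hd⟩ := exists_topologicalKrullDim_le_of_locallyOfFiniteType f
  have hZ : ∀ (K : Type) [Field K] [Algebra k K] [Algebra.EssFiniteType k K],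
      ∀ M₁ M₂ : ProjModel k K, ∃ (N : ProjModel k K) (φ₁ : N.Hom M₁) (φ₂ : N.Hom M₂),
        φ₁.RegLe ∧ φ₂.RegLe :=
    fun K _ _ _ M₁ M₂ => projTwoModelPatching_of_projRegLeification (hRL K) M₁ M₂
  have hLU' : ∀ (K : Type) [Field K] [Algebra k K] (O : ValuationSubring K) (R : Subalgebra k K),
      R.FG → IsFractionRing R K → R.toSubring ≤ O.toSubring →
        ∃ (A : Subalgebra k K) (h : A.toSubring ≤ O.toSubring), R ≤ A ∧ A.FG ∧
          IsRegularLocalRing (Localization.AtPrime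
            (Ideal.comap (Subring.inclusion h) (IsLocalRing.maximalIdeal O))) := by
    intro K _ _ O R hRfg hRfr hRO
    haveI : Algebra.FiniteType k R := R.fg_iff_finiteType.mp hRfg
    haveI : Algebra.EssFiniteType R K :=
      Algebra.EssFiniteType.of_isLocalization K (nonZeroDivisors R)
    have hKfg : (⊤ : IntermediateField k K).FG :=
      IntermediateField.fg_top_iff.mpr (Algebra.EssFiniteType.comp k R K)
    obtain ⟨A, h, hle, hAfg, -, hreg⟩ :=
      hLU K hKfg O (fun c => hRO (R.algebraMap_mem c)) R hRfg hRO
    exact ⟨A, h, hle, hAfg, hreg⟩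
  exact resolutionOverUpToDim_of_twoModelPatching_of_relLU hZ hLU' d X f hs hl hq hr hd

end Summit.ResolutionOfSingularities.ResolutionOfSingularities.Theorems.PatchingPerfect.Negative

end
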